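import Mathlib
import Literature.Barriers.ValiantsHypothesis.AlgebraicNaturalProofs
import Literature.Computability.AlgebraicComplexity.ArithCircuitProofs
import Summits.ValiantsHypothesis.ValiantsHypothesis.Theorems.BarrierLeverSuccinctHittingSetsForVPSparse
import HarnessLib

/-!
# Crux `BarrierLever.SuccinctHittingSetsForVP` (stmt-ValiantsHypothesis-14610), line `registered` —
SPARSE DISTINGUISHERS ARE HIT INSIDE THE MULTILINEAR SLICE (registered stub
`stub_multilinearSparseGlue`; it does NOT close the item)

**What is proved.** The registered glue stub `stub_multilinearSparseGlue` of the skeleton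
`Cruxes/SuccinctHittingSetsForVP/Lines/birth.lean`: GIVEN the statements of the two neighbour
stubs — `∏_i (1 + x_i)` is a multilinear member of `SmallCircuits ℂ n 2` whose coefficient vector is
the indicator of the multilinear exponents (`stub_multilinearBase`), and the multilinear coordinates
form a `Finset T` of `degLEMonomials n` (`stub_multilinearCoords`) — for every sparsity exponent `a`,
for all `n ≥ 8a + 2`, every polynomial `D` in the `N = C(2n,n)` coefficient variables with at most
`N^a` monomials that is nonzero at the coefficient vector of SOME multilinear polynomial is nonzero at
the coefficient vector of a MULTILINEAR member of `SmallCircuits ℂ n 3`: Forbes–Shpilka–Volk 2018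
Thm. 9 in their own multilinear regime, i.e. the sparse case of the `multilinearSlice`-relative
barrier hypothesis (`IsSuccinctHittingSetRel`).

Mechanism: kill the non-multilinear coordinates (`X_μ ↦ 0` for `μ ∉ T`; this does not change the
value at the coefficient vector of any multilinear polynomial, `eval_subst_of_multilinear`),
transport the result to the polynomial ring on the multilinear coordinates `↥T`
(`exists_rename_eq_of_vars_subset_range`), apply FSV Lemma 32 there with the all-ones shift
(`ShiftSmallSupport.exists_narrow_monomial` fed by `stub_prodSparsity`): the shift has a monomial `m`
with `2^|supp m| ≤ |supp D| ≤ N^a ≤ 2^(2an)`; take a non-root `1 + w` of the shifted polynomial with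
`w` supported on `supp m` (`LowSupport.exists_eval_ne_zero_supported`), and hit with the multilinear
small circuit `∏_i (1 + x_i) + Σ_{ν ∈ supp m} w_ν x^ν` (size budget `n² + 2an(2n+2) + 1 ≤ n³` for
`n ≥ 8a + 2`). Axioms: `propext`, `Classical.choice`, `Quot.sound`.
References: [ForbesShpilkaVolk2018] Thm. 9, Lemma 32–33, Cor. 34.
-/

-- layout Summits/ValiantsHypothesis/ValiantsHypothesis forces the duplicated namespace component
set_option linter.dupNamespace false

namespace Summit.ValiantsHypothesis.ValiantsHypothesis.Theorems.BarrierLever.SuccinctHittingSetsForVP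

open Literature.Barriers.ValiantsHypothesis Literature.Computability.AlgebraicComplexity MvPolynomial

namespace MultilinearSparseGlue

/-- The size budget of the multilinear hitting polynomial: for `n ≥ 8a + 2`,
`n² + 2an(2n+2) + 1 ≤ n³`. [folklore] -/
theorem size_budget3 {a n : ℕ} (hn : 8 * a + 2 ≤ n) :
    n ^ 2 + 2 * a * n * (2 * n + 2) + 1 ≤ n ^ 3 := by
  have h1 : 1 ≤ n := by omega
  have hn2 : 1 ≤ n ^ 2 := Nat.one_le_pow _ _ h1
  have hmain : (8 * a + 2) * n ^ 2 ≤ n * n ^ 2 := Nat.mul_le_mul_right _ hn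
  have hlin : 4 * a * n ≤ 4 * a * n * n := Nat.le_mul_of_pos_right _ h1
  calc n ^ 2 + 2 * a * n * (2 * n + 2) + 1
      = n ^ 2 + (4 * a * n * n + 4 * a * n) + 1 := by ring
    _ ≤ n ^ 2 + (4 * a * n * n + 4 * a * n * n) + n ^ 2 := by gcongr
    _ = (8 * a + 2) * n ^ 2 := by ring
    _ ≤ n * n ^ 2 := hmain
    _ = n ^ 3 := by ring

section Subst

variable {ι : Type*} [DecidableEq ι]

/-- Killing the variables outside `S` does not increase the number of monomials. [folklore] -/
theorem card_support_subst_le (S : Finset ι) (D : MvPolynomial ι ℂ) :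
    (aeval (fun i => if i ∈ S then (X i : MvPolynomial ι ℂ) else 0) D).support.card ≤
      D.support.card :=
  (Finset.card_le_card (ShiftSmallSupport.support_subst_subset S D)).trans
    (Finset.card_filter_le _ _)

/-- After killing the variables outside `S`, only variables of `S` occur. [folklore] -/
theorem vars_subst_subset_range (S : Finset ι) (D : MvPolynomial ι ℂ) :
    (↑(aeval (fun i => if i ∈ S then (X i : MvPolynomial ι ℂ) else 0) D).vars : Set ι) ⊆
      Set.range (Subtype.val : ↥S → ι) := by
  intro i hi
  obtain ⟨m, hm, him⟩ := (mem_vars_iff_mem_support i).mp (Finset.mem_coe.mp hi)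
  obtain ⟨-, hsub⟩ := Finset.mem_filter.mp (ShiftSmallSupport.support_subst_subset S D hm)
  exact ⟨⟨i, hsub him⟩, rfl⟩

/-- Hence the killed polynomial is (the renaming of) a polynomial in the variables of `S` only.
[folklore] -/
theorem exists_rename_eq_subst (S : Finset ι) (D : MvPolynomial ι ℂ) :
    ∃ E : MvPolynomial ↥S ℂ, rename (Subtype.val : ↥S → ι) E =
      aeval (fun i => if i ∈ S then (X i : MvPolynomial ι ℂ) else 0) D :=
  exists_rename_eq_of_vars_subset_range _ _ Subtype.val_injective (vars_subst_subset_range S D)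

/-- Renaming along the inclusion of `S` preserves the number of monomials. [folklore] -/
theorem card_support_rename_val (S : Finset ι) (E : MvPolynomial ↥S ℂ) :
    (rename (Subtype.val : ↥S → ι) E).support.card = E.support.card := by
  rw [support_rename_of_injective Subtype.val_injective,
    Finset.card_image_of_injective _ (Finsupp.mapDomain_injective Subtype.val_injective)]

end Subst

section Multilinear

variable {n : ℕ}

/-- A multilinear polynomial has zero coefficient at every non-multilinear exponent (the exponents
outside the finite set `T` of multilinear coordinates). [folklore] -/
theorem coeff_eq_zero_of_notMem {T : Finset (degLEMonomials n)}
    (hT : ∀ μ : degLEMonomials n, μ ∈ T ↔ ∀ i, (μ : Fin n →₀ ℕ) i ≤ 1)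
    {h : MvPolynomial (Fin n) ℂ} (hh : h ∈ multilinearSlice ℂ n)
    {μ : degLEMonomials n} (hμ : μ ∉ T) : coeff (μ : Fin n →₀ ℕ) h = 0 := by
  rw [← notMem_support_iff]
  intro hmem
  exact hμ ((hT μ).mpr (hh _ hmem))

/-- Killing the non-multilinear coordinates of `D` does not change its value at the coefficient
vector of a multilinear polynomial. [cite: ForbesShpilkaVolk2018, Thm. 9 and Lemma 32] -/
theorem eval_subst_of_multilinear {T : Finset (degLEMonomials n)}
    (hT : ∀ μ : degLEMonomials n, μ ∈ T ↔ ∀ i, (μ : Fin n →₀ ℕ) i ≤ 1)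
    {h : MvPolynomial (Fin n) ℂ} (hh : h ∈ multilinearSlice ℂ n)
    (D : MvPolynomial (degLEMonomials n) ℂ) :
    eval (coeffVector (degLEMonomials n) h)
        (aeval (fun μ => if μ ∈ T then (X μ : MvPolynomial (degLEMonomials n) ℂ) else 0) D) =
      eval (coeffVector (degLEMonomials n) h) D := by
  rw [LowDegree.eval_subst]
  have hfun : (fun μ => if μ ∈ T then coeffVector (degLEMonomials n) h μ else 0) =
      coeffVector (degLEMonomials n) h := by
    funext μ
    split_ifs with hμ
    · rfl
    · rw [coeffVector_apply, coeff_eq_zero_of_notMem hT hh hμ]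
  rw [hfun]

/-- Adding to a multilinear polynomial a linear combination of multilinear monomials keeps it
multilinear. [folklore] -/
theorem add_sparse_mem_multilinearSlice {f₁ : MvPolynomial (Fin n) ℂ}
    (hf₁ : f₁ ∈ multilinearSlice ℂ n) (S : Finset (degLEMonomials n))
    (hS : ∀ μ ∈ S, ∀ i, (μ : Fin n →₀ ℕ) i ≤ 1) (W : degLEMonomials n → ℂ) :
    f₁ + ∑ μ ∈ S, monomial (μ : Fin n →₀ ℕ) (W μ) ∈ multilinearSlice ℂ n := by
  intro m hm i
  rcases Finset.mem_union.mp (support_add hm) with h | h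
  · exact hf₁ m h i
  · obtain ⟨μ, hμ, hmμ⟩ := Finset.mem_biUnion.mp (support_sum h)
    rw [Finset.mem_singleton.mp (support_monomial_subset hmμ)]
    exact hS μ hμ i

/-- **The evaluation identity of the glue.** If `f₁` has the indicator of the multilinear exponents
as coefficient vector, `W` vanishes off `S`, `f₁ + Σ_{μ ∈ S} W_μ x^μ` is multilinear, and `E` is the
polynomial in the multilinear coordinates whose renaming is `D` with the non-multilinear coordinates
killed, then `D(coeff(f₁ + Σ_{μ ∈ S} W_μ x^μ)) = E(1 + W|_T)`.
[cite: ForbesShpilkaVolk2018, Thm. 9 and Lemma 32] -/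
theorem eval_coeffVector_add_sparse {T : Finset (degLEMonomials n)}
    (hT : ∀ μ : degLEMonomials n, μ ∈ T ↔ ∀ i, (μ : Fin n →₀ ℕ) i ≤ 1)
    {f₁ : MvPolynomial (Fin n) ℂ}
    (hcoef₁ : ∀ μ : Fin n →₀ ℕ, coeff μ f₁ = if ∀ i, μ i ≤ 1 then 1 else 0)
    (S : Finset (degLEMonomials n)) {W : degLEMonomials n → ℂ} (hW : ∀ μ, μ ∉ S → W μ = 0)
    (hfml : f₁ + ∑ μ ∈ S, monomial (μ : Fin n →₀ ℕ) (W μ) ∈ multilinearSlice ℂ n)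
    (D : MvPolynomial (degLEMonomials n) ℂ) {E : MvPolynomial ↥T ℂ}
    (hE : rename (Subtype.val : ↥T → degLEMonomials n) E =
      aeval (fun μ => if μ ∈ T then (X μ : MvPolynomial (degLEMonomials n) ℂ) else 0) D) :
    eval (coeffVector (degLEMonomials n) (f₁ + ∑ μ ∈ S, monomial (μ : Fin n →₀ ℕ) (W μ))) D =
      eval (fun i : ↥T => 1 + W (i : degLEMonomials n)) E := by
  rw [← eval_subst_of_multilinear hT hfml D, ← hE, eval_rename,
    ShiftedSupport.coeffVector_shift f₁ S hW]
  have hfun : ((fun m : degLEMonomials n => coeff (m : Fin n →₀ ℕ) f₁ + W m) ∘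
      (Subtype.val : ↥T → degLEMonomials n)) = fun i : ↥T => 1 + W (i : degLEMonomials n) := by
    funext i
    rw [Function.comp_apply, hcoef₁, if_pos ((hT _).mp i.2)]
  rw [hfun]

end Multilinear

end MultilinearSparseGlue

open MultilinearSparseGlue

/-- **Registered stub `stub_multilinearSparseGlue`** (crux stmt-ValiantsHypothesis-14610, line
`registered`; sparse assembly RELATIVE TO THE MULTILINEAR SLICE): from the multilinear base circuit
`∏_i (1 + x_i) ∈ SmallCircuits ℂ n 2` (coefficient vector = indicator of the multilinear exponents)
and the finiteness of the multilinear coordinates, for every sparsity exponent `a`, eventually in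
`n`, every polynomial in the `C(2n,n)` coefficient variables with at most `C(2n,n)^a` monomials that
is nonzero at the coefficient vector of some multilinear polynomial is nonzero at the coefficient
vector of a multilinear member of `SmallCircuits ℂ n 3`.
[cite: ForbesShpilkaVolk2018, Thm. 9 and Lemma 32] -/
theorem stub_multilinearSparseGlue :
    (∀ n : ℕ, 2 ≤ n →
      (∏ i : Fin n, (1 + X i) : MvPolynomial (Fin n) ℂ) ∈ SmallCircuits ℂ n 2 ∧
      (∏ i : Fin n, (1 + X i) : MvPolynomial (Fin n) ℂ) ∈ multilinearSlice ℂ n ∧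
      ∀ μ : Fin n →₀ ℕ, MvPolynomial.coeff μ (∏ i : Fin n, (1 + X i) : MvPolynomial (Fin n) ℂ) =
        if ∀ i, μ i ≤ 1 then 1 else 0) →
    (∀ n : ℕ, ∃ T : Finset (degLEMonomials n),
      ∀ μ : degLEMonomials n, μ ∈ T ↔ ∀ i, (μ : Fin n →₀ ℕ) i ≤ 1) →
    ∀ a : ℕ, ∃ n₀ : ℕ, ∀ n : ℕ, n₀ ≤ n →
      IsSuccinctHittingSetRel (degLEMonomials n) (multilinearSlice ℂ n) (SmallCircuits ℂ n 3)
        {D | D.support.card ≤ Nat.choose (2 * n) n ^ a} := by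
  intro hM1 hM3 a
  refine ⟨8 * a + 2, fun n hn => ?_⟩
  rintro D hD ⟨g, hg, hgne⟩
  have hDa : D.support.card ≤ Nat.choose (2 * n) n ^ a := hD
  obtain ⟨hf₁S, hf₁ml, hcoef₁⟩ := hM1 n (by omega)
  generalize (∏ i : Fin n, (1 + X i) : MvPolynomial (Fin n) ℂ) = f₁ at hf₁S hf₁ml hcoef₁
  obtain ⟨T, hT⟩ := hM3 n
  -- Step 1: killing the non-multilinear coordinates leaves `D` nonzero
  have hρ0 : aeval (fun μ => if μ ∈ T then (X μ : MvPolynomial (degLEMonomials n) ℂ) else 0) D ≠ 0 := by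
    intro h0
    apply hgne
    rw [← eval_subst_of_multilinear hT hg D, h0, map_zero]
  -- Step 2: transport to the polynomial ring on the multilinear coordinates
  obtain ⟨E, hE⟩ := exists_rename_eq_subst T D
  have hE0 : E ≠ 0 := by
    rintro rfl
    exact hρ0 (by rw [← hE, map_zero])
  have hEcard : E.support.card ≤ 2 ^ (2 * a * n) := by
    rw [← card_support_rename_val T E, hE]
    exact (card_support_subst_le T D).trans (hDa.trans SparseGlue.choose_pow_le)
  -- Step 3: FSV Lemma 32 with the all-ones shift: a narrow monomial `m`
  obtain ⟨m, hm, hmcard⟩ :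
      ∃ m ∈ (aeval (fun i : ↥T => C (1 : ℂ) + X i) E).support,
        2 ^ m.support.card ≤ E.support.card :=
    ShiftSmallSupport.exists_narrow_monomial (fun _ => (1 : ℂ))
      (fun S H hH => stub_prodSparsity _ S (fun _ => (1 : ℂ)) (fun _ _ => one_ne_zero) H hH) hE0
  have hmt : m.support.card ≤ 2 * a * n :=
    (Nat.pow_le_pow_iff_right (by norm_num)).mp (hmcard.trans hEcard)
  -- Step 4: a non-root `1 + w` of `E` with `w` supported on `supp m`
  obtain ⟨w, hw, hne⟩ := LowSupport.exists_eval_ne_zero_supported hm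
  have hne' : eval (fun i => (1 : ℂ) + w i) E ≠ 0 := by
    rwa [ShiftedSupport.eval_shift] at hne
  -- Step 5: the multilinear hitting polynomial `f₁ + Σ_{ν ∈ supp m} w_ν x^ν`
  obtain ⟨W, hWdef⟩ : ∃ W : degLEMonomials n → ℂ,
      W = fun μ => if h : μ ∈ T then w ⟨μ, h⟩ else 0 := ⟨_, rfl⟩
  have hWval : ∀ i : ↥T, W (i : degLEMonomials n) = w i := by
    intro i
    rw [hWdef]
    dsimp only
    rw [dif_pos i.2]
  have hST : ∀ μ ∈ m.support.image Subtype.val, μ ∈ T := by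
    intro μ hμ
    obtain ⟨i, -, rfl⟩ := Finset.mem_image.mp hμ
    exact i.2
  have hW : ∀ μ, μ ∉ m.support.image Subtype.val → W μ = 0 := by
    intro μ hμ
    rw [hWdef]
    dsimp only
    split_ifs with h
    · exact hw ⟨μ, h⟩ fun hmem => hμ (Finset.mem_image.mpr ⟨⟨μ, h⟩, hmem, rfl⟩)
    · rfl
  have hScard : (m.support.image Subtype.val).card ≤ 2 * a * n :=
    Finset.card_image_le.trans hmt
  have hfml : f₁ + ∑ μ ∈ m.support.image Subtype.val, monomial (μ : Fin n →₀ ℕ) (W μ) ∈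
      multilinearSlice ℂ n :=
    add_sparse_mem_multilinearSlice hf₁ml _ (fun μ hμ => (hT μ).mp (hST μ hμ)) W
  refine ⟨f₁ + ∑ μ ∈ m.support.image Subtype.val, monomial (μ : Fin n →₀ ℕ) (W μ),
    ShiftedSupport.shift_mem_smallCircuits (size_budget3 hn) hf₁S _ hScard W, hfml, ?_⟩
  rw [eval_coeffVector_add_sparse hT hcoef₁ _ hW hfml D hE]
  have hfun : (fun i : ↥T => (1 : ℂ) + W (i : degLEMonomials n)) = fun i => 1 + w i :=
    funext fun i => by rw [hWval]
  rw [hfun]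
  exact hne'

end Summit.ValiantsHypothesis.ValiantsHypothesis.Theorems.BarrierLever.SuccinctHittingSetsForVP
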